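import Summits.QuantumFields.BalabanUV.Beta.GAN24.RelInvWardPairingStep
import Summits.QuantumFields.BalabanUV.Beta.GAN24.ChargeTowerStep
import Summits.QuantumFields.BalabanUV.Beta.GAN24.WardResidualFieldTotals
import Summits.QuantumFields.BalabanUV.Beta.WardLocusSecondOrder
import Summits.QuantumFields.BalabanUV.Beta.GAN24.EdgePotentialColumnOrthogonal

/-!
# `BalabanUV.Beta.GAN24.ChargeTowerClimb` — binder row G-an2-4 ∕ (CONV-C), the (S) row ∕ (W-γ) AT EVERY LEVEL («the Δ_j-exact charge tower», road-P2 gen 41, memo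
# `HOME/b2b-balaban-gan24-p2/gen41/W-GAMMA-TOWER-v0.md`, identities (I4)+(I5) composed): **THE POTENTIAL CLIMBS** — the `ℋ`-column read of a `Δ_{j+1}`-EXACT-PLUS-CONSTANT slot field
# through the co-dressed step resolvent `G_{j+1}` is `Δ_{j+2}`-exact plus constant, with the next potential `(σ_{j+1}∕wVH_{j+2})·𝒬_{Lc} m` and the next constant `c_ν·Lc^d·(σ_{j+1}·Lc^{d+1})⁻¹`

NOT IN PRINT; OUR BOOKKEEPING ([folklore] by name: my `RelInvWardPairingStep.tsum_E2image_mul_colH_eq` (the level-(j+1) column pairing, an2's straight step candidate `bhKStep`), leaf-06 g46's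
`RelInvWardPairing.ward_pairing_coDressKBmAt_KInvStep_zero` (level 0), the dictionary `(G_j)_mm = E2_{j+1}` (`KernelWardMColumn.colM_coDressKBmAt`, gan24-leaf-14's `MultiplierZeroMass.colM_KInvStep`,
leaf-10∕an2's `WardLocusSecondOrder.colM_coDressKBmAt_KInvStep`), the symmetry `TransverseDictionary.wΦ_symm`, and my g39∕leaf-side column total `WardResidualFieldTotals.colTotal_eq`; 0 `def`,
0 cited fact, 0 `def … : Prop`, 0 sorry).  HONEST FRAMING (cell contract, verbatim): «discharging `BetaPertH` makes Bałaban's UV stability UNCONDITIONAL — a real constructive-QFT result;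
it is NOT the continuum limit and NOT the Clay problem.»  HONEST DEPENDENCY (verbatim): «continuum YM on T⁴ ⇐ BetaPertH ∧ nine spine estimates (0/9 proved); BetaPertH ⇐ (D1) ∧ (D4) ∧ CAP+tail;
G-an2-4 gates asym, D1 and NE2/3/4.»

Notation: `G_j := coDressKBmAt (toSite r) Lc (KInvStep Lc j)` (in-block root `r`), `σ_j := stepScale d Lc j = (Lc^j)^{d+2}`, `(Δ_{j+1} m)(κ,u) := wVH_{j+1}·Σ'_v Σ_l wΦ_{Lc^{j+1}} κ l (u − v)·m l v`
(the field block of `bhKStep d Lc (j+1)` applied to `m`), `𝒬_{Lc} m := contourSum Lc m` (straight-contour block sums), `colH K N ν y′ κ u := K u (N•y′) (inl κ) (inr ν)`.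
* §1 `abs_tsum_sum_wΦ_mul_le` (the value-Hessian image of a bounded form is bounded: `|Σ'_v Σ_l wΦ κ l (u − v)·m l v| ≤ B·Σ_l Σ'_z |wΦ κ l z|`), `summable_colH` (an `ℋ`-column of `G_j` is summable
  in the fine slot), `summable_bdd_mul_colH`.
* §2 **`tsum_sum_const_mul_colH`** (THE CONSTANT PART, every `j`): `Σ'_u Σ_κ c κ·colH G_j Lc ν y′ κ u = c ν·(Lc^d·(σ_j·Lc^{d+1})⁻¹)` — slot-free (`colTotal_eq`).
* §3 **`tsum_sum_E2image_mul_colH_eq_E2`** (every `j`, `m` bounded and zero on the comb bonds): `Σ'_u Σ_κ (Δ_{j+1} m)(κ,u)·colH G_{j+1} Lc ν y′ κ u = σ_{j+1}·Σ'_y Σ_κ E2 d Lc (j+2) y y′ (inl κ)(inl ν)·(𝒬m) κ y`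
  ((I4) my column pairing ⨾ (I5) `colM G_{j+1} = E2_{j+2}`), and **`tsum_sum_E2image_mul_colH_climbs`**: the same `= wVH_{j+2}·Σ'_y Σ_κ wΦ_{Lc^{j+2}} ν κ (y′ − y)·((σ_{j+1}∕wVH_{j+2})·(𝒬m) κ y)` —
  LITERALLY the shape `(Δ_{j+2} m′)(ν, y′)` with `m′ := (σ_{j+1}∕wVH_{j+2})·𝒬_{Lc} m`: THE POTENTIAL CLIMBS ONE LEVEL.
* §4 **`tsum_sum_curvAdj_curv_mul_colH_zero_eq_E2`** (level `0 → 1`, leaf-06's pairing): `Σ'_u Σ_κ (d*d m)(κ,u)·colH G_0 Lc ν y′ κ u = Σ'_y Σ_κ E2 d Lc 1 y y′ (inl κ)(inl ν)·(𝒬m) κ y`.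
* §5 **`sum_tsum_colH_mul_affine`** (THE AFFINE STEP in the consumer's order `Σ_κ Σ'_u colH·C`, the shape `ChargeTowerStep.tsum_weighted_vertexOfK` produces): for `C κ u := (Δ_{j+1} m)(κ,u) + c κ`,
  `Σ_κ Σ'_u colH G_{j+1} Lc ν y′ κ u·C κ u = wVH_{j+2}·Σ'_y Σ_κ wΦ_{Lc^{j+2}} ν κ (y′ − y)·((σ_{j+1}∕wVH_{j+2})·(𝒬m) κ y) + c ν·(Lc^d·(σ_{j+1}·Lc^{d+1})⁻¹)`.
* §6 **`tsum_weighted_vertexOfK_of_exact_add_const`** (THE INDUCTION STEP FOR A GENERIC STENCIL FAMILY, (I1)'s vertex form ⨾ §5): for ANY local stencil family `S` and bounded weights `g₁ g₂`, IF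
  the level-(j+1) weighted charge function `u ↦ Σ'_{(y,w)} g₁(y)·g₂(w)·S κ u y w a b` equals `(Δ_{j+1} m)(κ,u) + c κ` (bounded `m` zero on the comb bonds), THEN the weighted charge of the
  chain-rule vertex through `G_{j+1}` is `Σ'_{(y,w)} g₁(y)·(vertexOfK G_{j+1} Lc S ν y′) y w a b·g₂(w) = (Δ_{j+2} m′)(ν,y′) + c ν·(Lc^d·(σ_{j+1}·Lc^{d+1})⁻¹)` (`ChargeTowerStep.tsum_weighted_vertexOfK` ⨾ §5).
* §7 **`hasSum_prod_coordWeighted_SpureRecAt_of_exact_add_const`** (THE S-PURE INDUCTION STEP, (I1) ⨾ §6): IF the exit-supported block-constant charge function of the FULL member `SrecAt (j+1)`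
  (weights `𝟙^{exit}_α·f₁∘blk ⊗ 𝟙^{exit}_β·f₂∘blk`, channel `(inl α, inl β)`) is `(Δ_{j+1} m) + c`, THEN the class-𝒟 charge function `(x,z) ↦ f₁(x_α)·f₂(z_β)` of `SpureRecAt (j+2)` at slot `(ν,y′)`
  HAS the sum `(cE·wE_{j+2})·cH_{j+1}²·((Δ_{j+2} m′)(ν,y′) + c ν·Lc^d·(σ_{j+1}·Lc^{d+1})⁻¹)` — `Δ_{j+2}`-exact plus constant in the slot, explicitly.
* §8 **`tsum_sum_E2image_mul_colH_eq_zero_of_periodic`** ((M1) AT EVERY LEVEL `j+1` — the twin of leaf-06 g46's `EdgePotentialColumnOrthogonal.tsum_curvAdj_curv_mul_colH_eq_zero`): for `m` bounded,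
  zero on the comb bonds AND `Lc`-PERIODIC, `Σ'_u Σ_κ (Δ_{j+1} m)(κ,u)·colH G_{j+1} Lc ν y′ κ u = 0` (§3 ⨾ `𝒬m` block-constant ⨾ `Σ'_y E2_{j+2} y y′ (inl κ)(inl ν) = Σ'_z wΦ κ ν z = 0`): the exact part
  of a charge function with an `Lc`-periodic potential contributes NOTHING one level up — only the `Lc^m`-periodic classes (`m ≥ 2`) climb.
READING (the tower's induction, exact part): if the level-(j+1) weighted charge function of the stencil family is `Δ_{j+1}`-exact plus a per-direction constant ((I3)_{j+1}; engine E28 (B):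
jb = 1, `Δ₁ = E2[1]`, exact to 2e-15–2e-14), then its `ℋ`-column read — which IS the level-(j+2) charge function by (I1) `ChargeTowerStep` — is `Δ_{j+2}`-exact plus constant, with the
potential and constant named here.  What this file does NOT supply: the re-gauging of `m′` off the next comb (leaf-06's periodic∕hard-axial representative business), the fresh `Λ_{j+2}`∕`VH_{j+2}`
pieces of the next member, and (I3)_0 (leaf-02 g57's `SrecChargeBlockPotentials`).  Asserts NO value of Bałaban's tables; discharges NOTHING of (W-γ)'s exit sub-row ∕ (INV) ∕ (S) ∕ (Q-R) ∕
(LT) ∕ (Q-L) ∕ (C) ∕ «T2Shape» ∕ «T2Drift» ∕ (hW, hWall); NEVER «G-an2-4 closed» as (CONV-C); NOT D1, NOT `BetaPertH`, NOT continuum, NOT Clay.  2026-08-22; no existing file touched.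
-/

noncomputable section

open Finset
open scoped BigOperators
open Literature.MathematicalPhysics.QuantumFieldTheory
open Literature.MathematicalPhysics.QuantumFieldTheory.Balaban1983to89
open Literature.MathematicalPhysics.QuantumFieldTheory.Balaban1983to89.Beta
open B12Sec2to5 (l1 l1_nonneg)
open ExpKernelCalculus (Site MKer Decays comp summable_exp_shift' tsum_exp_shift')
open AffineAveraging (Form1 box toSite unitVec contourSum curv curvAdj)
open KernelSpecInstance (wΦ)
open OneStepResolventKernel (Fib LocStencil)
open OneStepKernelFamily (KInvStep colH abs_colH_le vertexOfK)
open SecondOrderResponse (colM)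
open AveragingContours (blk)
open BalabanStepJetsSucc (E2 wVH wE)
open Summit.QuantumFields.BalabanUV.Beta.TameKernelCalculus (Spr spr_idK)
open HessKerSchurResolvent (idK idK_apply comp_idK_right)
open Summit.QuantumFields.BalabanUV.Beta.AxialDressingRooted (IsCombBondAt coDressKBmAt decays_coDressKBmAt_KInvStep one_le_of_neZero)
open Summit.QuantumFields.BalabanUV.Beta.BorderedHessian (stepScale stepScale_ne_zero)
open Summit.QuantumFields.BalabanUV.Beta.SpineRooted (SpureRecAt)
open Summit.QuantumFields.BalabanUV.Beta.WardLocusRecursive (SrecAt locStencil_SrecAt)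
open Summit.QuantumFields.BalabanUV.Beta.KernelWardMColumn (colM_coDressKBmAt)
open Summit.QuantumFields.BalabanUV.Beta.WardLocusSecondOrder (colM_coDressKBmAt_KInvStep)
open Summit.QuantumFields.BalabanUV.Beta.GAN24.MultiplierZeroMass (summable_wΦ colM_KInvStep tsum_wΦ_eq_zero)
open Summit.QuantumFields.BalabanUV.Beta.GAN24.EdgePotentialColumnOrthogonal (contourSum_add_coarse)
open Summit.QuantumFields.BalabanUV.Beta.GAN24.TransverseDictionary (wΦ_symm)
open Summit.QuantumFields.BalabanUV.Beta.GAN24.CoarseGaugeSourceResponse (summable_bdd_mul)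
open Summit.QuantumFields.BalabanUV.Beta.GAN24.WardResidualFieldTotals (colTotal_eq)
open Summit.QuantumFields.BalabanUV.Beta.GAN24.RelInvWardPairing (ward_pairing_coDressKBmAt_KInvStep_zero)
open Summit.QuantumFields.BalabanUV.Beta.GAN24.RelInvWardPairingStep (tsum_E2image_mul_colH_eq)
open Summit.QuantumFields.BalabanUV.Beta.GAN24.ChargeTowerStep (tsum_weighted_vertexOfK hasSum_prod_coordWeighted_SpureRecAt_succ_inl_inl)

namespace Summit.QuantumFields.BalabanUV.Beta.GAN24.ChargeTowerClimb

variable {d : ℕ} {Lc : ℕ} [NeZero Lc] {r : Fin (d + 1) → ℕ}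

/-! ## §1 Bounds and summabilities -/

omit [NeZero Lc] in
/-- [folklore] **THE VALUE-HESSIAN IMAGE OF A BOUNDED FORM IS BOUNDED**: `|Σ'_v Σ_l wΦ_M κ l (u − v)·m l v| ≤ B·Σ_l Σ'_z |wΦ_M κ l z|` (`wΦ` summable, `m` bounded by `B`). -/
theorem abs_tsum_sum_wΦ_mul_le (M : ℕ) [NeZero M] {m : Form1 (d + 1) ℝ} {B : ℝ} (hmB : ∀ κ u, |m κ u| ≤ B) (κ : Fin (d + 1)) (u : Site (d + 1)) :
    |∑' v, ∑ l : Fin (d + 1), wΦ (N := M) κ l (u - v) * m l v| ≤ B * ∑ l : Fin (d + 1), ∑' z : Site (d + 1), |wΦ (N := M) κ l z| := by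
  have hB0 : 0 ≤ B := (abs_nonneg _).trans (hmB 0 0)
  -- the reindexed absolute row is summable with the displayed sum
  have hrow : ∀ l, HasSum (fun v : Site (d + 1) => |wΦ (N := M) κ l (u - v)|) (∑' z : Site (d + 1), |wΦ (N := M) κ l z|) := by
    intro l
    have hs : Summable fun z : Site (d + 1) => |wΦ (N := M) κ l z| := (summable_wΦ (N := M) κ l).abs
    have h := ((Equiv.subLeft u).hasSum_iff).2 hs.hasSum
    simpa only [Function.comp_def, Equiv.subLeft_apply] using h
  have hmaj : ∀ v, |∑ l : Fin (d + 1), wΦ (N := M) κ l (u - v) * m l v| ≤ ∑ l : Fin (d + 1), B * |wΦ (N := M) κ l (u - v)| := by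
    intro v
    refine (Finset.abs_sum_le_sum_abs _ _).trans (Finset.sum_le_sum fun l _ => ?_)
    rw [abs_mul, mul_comm]
    exact mul_le_mul_of_nonneg_right (hmB l v) (abs_nonneg _)
  have hMs : HasSum (fun v => ∑ l : Fin (d + 1), B * |wΦ (N := M) κ l (u - v)|) (∑ l : Fin (d + 1), B * ∑' z : Site (d + 1), |wΦ (N := M) κ l z|) :=
    hasSum_sum fun l _ => (hrow l).mul_left B
  have hFs : Summable fun v => ∑ l : Fin (d + 1), wΦ (N := M) κ l (u - v) * m l v :=
    Summable.of_norm_bounded hMs.summable (fun v => by rw [Real.norm_eq_abs]; exact hmaj v)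
  calc |∑' v, ∑ l : Fin (d + 1), wΦ (N := M) κ l (u - v) * m l v|
      ≤ ∑' v, |∑ l : Fin (d + 1), wΦ (N := M) κ l (u - v) * m l v| := by
        rw [← Real.norm_eq_abs]
        refine (norm_tsum_le_tsum_norm hFs.norm).trans (le_of_eq ?_)
        simp only [Real.norm_eq_abs]
    _ ≤ ∑' v, ∑ l : Fin (d + 1), B * |wΦ (N := M) κ l (u - v)| :=
        hFs.abs.tsum_le_tsum hmaj hMs.summable
    _ = B * ∑ l : Fin (d + 1), ∑' z : Site (d + 1), |wΦ (N := M) κ l z| := by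
        rw [hMs.tsum_eq, Finset.mul_sum]

/-- [folklore] An `ℋ`-column of `G_j` is summable in the fine slot (decay from the coarse point). -/
theorem summable_colH (hr : r ∈ box (d + 1) Lc) (j : ℕ) (ν : Fin (d + 1)) (y' : Site (d + 1)) (κ : Fin (d + 1)) :
    Summable fun u : Site (d + 1) => colH (coDressKBmAt (toSite r) Lc (KInvStep (d := d) Lc j)) Lc ν y' κ u := by
  obtain ⟨δ, C, hδ, -, hG⟩ := decays_coDressKBmAt_KInvStep (d := d) hr j
  exact Summable.of_norm_bounded ((summable_exp_shift' hδ ((Lc : ℤ) • y')).mul_left C)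
    (fun u => by rw [Real.norm_eq_abs]; exact abs_colH_le hG ν y' κ u)

/-- [folklore] A bounded slot field against an `ℋ`-column of `G_j` is summable in the fine slot. -/
theorem summable_bdd_mul_colH (hr : r ∈ box (d + 1) Lc) (j : ℕ) {A : Form1 (d + 1) ℝ} {B : ℝ} (hA : ∀ κ u, |A κ u| ≤ B) (ν : Fin (d + 1)) (y' : Site (d + 1))
    (κ : Fin (d + 1)) :
    Summable fun u : Site (d + 1) => A κ u * colH (coDressKBmAt (toSite r) Lc (KInvStep (d := d) Lc j)) Lc ν y' κ u :=
  summable_bdd_mul (summable_colH hr j ν y' κ) (hA κ)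

/-! ## §2 The constant part: column totals -/

/-- NOT IN PRINT; OUR BOOKKEEPING.  **THE CONSTANT PART OF THE `ℋ`-COLUMN READ** (every `j`, in-block root, slot-free): `Σ'_u Σ_κ c κ·colH G_j Lc ν y′ κ u = c ν·(Lc^d·(σ_j·Lc^{d+1})⁻¹)` —
`WardResidualFieldTotals.colTotal_eq` (`Σ'_u colH G_j Lc ν y′ κ u = 𝟙[κ = ν]·Lc^d·(σ_j·Lc^{d+1})⁻¹`). -/
theorem tsum_sum_const_mul_colH (hr : r ∈ box (d + 1) Lc) (j : ℕ) (c : Fin (d + 1) → ℝ) (ν : Fin (d + 1)) (y' : Site (d + 1)) :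
    ∑' u, ∑ κ, c κ * colH (coDressKBmAt (toSite r) Lc (KInvStep (d := d) Lc j)) Lc ν y' κ u
      = c ν * ((Lc : ℝ) ^ d * (stepScale d Lc j * (Lc : ℝ) ^ (d + 1))⁻¹) := by
  classical
  have hLc : 1 ≤ Lc := one_le_of_neZero Lc
  rw [Summable.tsum_finsetSum (fun κ _ => (summable_colH hr j ν y' κ).mul_left (c κ))]
  simp only [tsum_mul_left]
  simp only [colTotal_eq hLc hr j ν _ y', mul_ite, mul_zero]
  rw [Finset.sum_ite_eq' Finset.univ ν, if_pos (Finset.mem_univ ν)]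

/-! ## §3 The exact part climbs: level `j + 1 → j + 2` -/

/-- NOT IN PRINT; OUR BOOKKEEPING.  **(I4)⨾(I5): THE `Δ_{j+1}`-IMAGE OF `m` READ THROUGH AN `ℋ`-COLUMN OF `G_{j+1}` IS `σ_{j+1}` × THE `E2_{j+2}`-IMAGE OF `𝒬m`** (every `j`, in-block root, `m` bounded and
zero on the comb bonds): `Σ'_u Σ_κ (wVH_{j+1}·Σ'_v Σ_l wΦ_{Lc^{j+1}} κ l (u − v)·m l v)·colH G_{j+1} Lc ν y′ κ u = σ_{j+1}·Σ'_y Σ_κ E2 d Lc (j+2) y y′ (inl κ)(inl ν)·(𝒬_{Lc} m) κ y` — my column pairing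
`tsum_E2image_mul_colH_eq` and the dictionary `colM G_{j+1} Lc ν y′ κ y = E2 d Lc (j+2) y y′ (inl κ)(inl ν)` (`WardLocusSecondOrder.colM_coDressKBmAt_KInvStep`). -/
theorem tsum_sum_E2image_mul_colH_eq_E2 (hr : r ∈ box (d + 1) Lc) (j : ℕ) {m : Form1 (d + 1) ℝ} {B : ℝ} (hmB : ∀ κ u, |m κ u| ≤ B)
    (hm0 : ∀ κ u, IsCombBondAt (toSite r) Lc κ u → m κ u = 0) (ν : Fin (d + 1)) (y' : Site (d + 1)) :
    ∑' u, ∑ κ, (wVH d Lc (j + 1) * ∑' v, ∑ l : Fin (d + 1), wΦ (N := Lc ^ (j + 1)) κ l (u - v) * m l v)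
        * colH (coDressKBmAt (toSite r) Lc (KInvStep (d := d) Lc (j + 1))) Lc ν y' κ u
      = stepScale d Lc (j + 1) * ∑' y, ∑ κ, E2 d Lc (j + 2) y y' (Sum.inl κ) (Sum.inl ν) * contourSum Lc m κ y := by
  have h := tsum_E2image_mul_colH_eq (d := d) hr j hmB hm0 ν y'
  simp only [colH]
  rw [h]
  congr 1
  refine tsum_congr fun y => Finset.sum_congr rfl fun κ _ => ?_
  have e : coDressKBmAt (toSite r) Lc (KInvStep (d := d) Lc (j + 1)) ((Lc : ℤ) • y) ((Lc : ℤ) • y') (Sum.inr κ) (Sum.inr ν)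
      = colM (coDressKBmAt (toSite r) Lc (KInvStep (d := d) Lc (j + 1))) Lc ν y' κ y := rfl
  rw [e, colM_coDressKBmAt_KInvStep, mul_comm]

/-- NOT IN PRINT; OUR BOOKKEEPING.  **THE POTENTIAL CLIMBS ONE LEVEL** (every `j`, in-block root, `m` bounded and zero on the comb bonds):
`Σ'_u Σ_κ (Δ_{j+1} m)(κ,u)·colH G_{j+1} Lc ν y′ κ u = wVH_{j+2}·Σ'_y Σ_κ wΦ_{Lc^{j+2}} ν κ (y′ − y)·((σ_{j+1}∕wVH_{j+2})·(𝒬_{Lc} m) κ y)` — the right side IS `(Δ_{j+2} m′)(ν, y′)` with the next potential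
`m′ := (σ_{j+1}∕wVH_{j+2})·𝒬_{Lc} m` (`colM (KInvStep Lc (j+1)) = wΦ_{Lc^{j+2}}`, `MultiplierZeroMass.colM_KInvStep`; `wΦ κ ν (y − y′) = wΦ ν κ (y′ − y)`, `wΦ_symm`). -/
theorem tsum_sum_E2image_mul_colH_climbs (hr : r ∈ box (d + 1) Lc) (j : ℕ) {m : Form1 (d + 1) ℝ} {B : ℝ} (hmB : ∀ κ u, |m κ u| ≤ B)
    (hm0 : ∀ κ u, IsCombBondAt (toSite r) Lc κ u → m κ u = 0) (ν : Fin (d + 1)) (y' : Site (d + 1)) :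
    ∑' u, ∑ κ, (wVH d Lc (j + 1) * ∑' v, ∑ l : Fin (d + 1), wΦ (N := Lc ^ (j + 1)) κ l (u - v) * m l v)
        * colH (coDressKBmAt (toSite r) Lc (KInvStep (d := d) Lc (j + 1))) Lc ν y' κ u
      = wVH d Lc (j + 2) * ∑' y, ∑ κ, wΦ (N := Lc ^ (j + 2)) ν κ (y' - y) * ((stepScale d Lc (j + 1) / wVH d Lc (j + 2)) * contourSum Lc m κ y) := by
  have h := tsum_E2image_mul_colH_eq (d := d) hr j hmB hm0 ν y'
  simp only [colH]
  rw [h]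
  have hw : wVH d Lc (j + 2) ≠ 0 := by
    simp only [wVH]
    exact pow_ne_zero _ (pow_ne_zero _ (by exact_mod_cast NeZero.ne Lc))
  -- entrywise: the multiplier column of `G_{j+1}` is `wΦ_{Lc^{j+2}}`, symmetrised
  have e : ∀ y κ, contourSum Lc m κ y * coDressKBmAt (toSite r) Lc (KInvStep (d := d) Lc (j + 1)) ((Lc : ℤ) • y) ((Lc : ℤ) • y') (Sum.inr κ) (Sum.inr ν)
      = wΦ (N := Lc ^ (j + 2)) ν κ (y' - y) * contourSum Lc m κ y := by
    intro y κ
    have e1 : coDressKBmAt (toSite r) Lc (KInvStep (d := d) Lc (j + 1)) ((Lc : ℤ) • y) ((Lc : ℤ) • y') (Sum.inr κ) (Sum.inr ν)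
        = colM (coDressKBmAt (toSite r) Lc (KInvStep (d := d) Lc (j + 1))) Lc ν y' κ y := rfl
    rw [e1, colM_coDressKBmAt, colM_KInvStep, wΦ_symm κ ν (y - y'), neg_sub, mul_comm]
  simp only [e]
  -- scalars: `σ·Σ = wVH·Σ (σ∕wVH)·…`
  have e2 : ∀ y, ∑ κ, wΦ (N := Lc ^ (j + 2)) ν κ (y' - y) * ((stepScale d Lc (j + 1) / wVH d Lc (j + 2)) * contourSum Lc m κ y)
      = (stepScale d Lc (j + 1) / wVH d Lc (j + 2)) * ∑ κ, wΦ (N := Lc ^ (j + 2)) ν κ (y' - y) * contourSum Lc m κ y := by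
    intro y
    rw [Finset.mul_sum]
    exact Finset.sum_congr rfl fun κ _ => by ring
  simp only [e2]
  rw [tsum_mul_left, ← mul_assoc, mul_div_cancel₀ _ hw]

/-! ## §8 The climb of an `Lc`-periodic potential is zero: (M1) at every level `j + 1` -/

/-- NOT IN PRINT; OUR BOOKKEEPING.  **EVERY BOUNDED, COMB-GAUGED, `Lc`-PERIODIC 1-FORM IS `Δ_{j+1}`-ORTHOGONAL TO EVERY `ℋ`-COLUMN OF `G_{j+1}`** (every `j`, in-block root; the level-(j+1) twin of
leaf-06 g46's `EdgePotentialColumnOrthogonal.tsum_curvAdj_curv_mul_colH_eq_zero`): `Σ'_u Σ_κ (wVH_{j+1}·Σ'_v Σ_l wΦ_{Lc^{j+1}} κ l (u − v)·m l v)·colH G_{j+1} Lc ν y′ κ u = 0` — §3 ⨾ the block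
contour sums of a periodic form do not depend on the block (`contourSum_add_coarse`) ⨾ the `mm` column sums vanish (`E2 d Lc (j+2) y y′ (inl κ)(inl ν) = wΦ_{Lc^{j+2}} κ ν (y − y′)`,
gan24-leaf-14 `MultiplierZeroMass.tsum_wΦ_eq_zero`).  READING: the `Δ`-exact part of a charge function whose potential is `Lc`-periodic contributes NOTHING to the next level's charge function;
only the `Lc^m`-periodic classes (`m ≥ 2`) climb. -/
theorem tsum_sum_E2image_mul_colH_eq_zero_of_periodic (hr : r ∈ box (d + 1) Lc) (j : ℕ) {m : Form1 (d + 1) ℝ} {B : ℝ} (hmB : ∀ κ u, |m κ u| ≤ B)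
    (hm0 : ∀ κ u, IsCombBondAt (toSite r) Lc κ u → m κ u = 0) (hper : ∀ κ x v, m κ (x + (Lc : ℤ) • v) = m κ x) (ν : Fin (d + 1)) (y' : Site (d + 1)) :
    ∑' u, ∑ κ, (wVH d Lc (j + 1) * ∑' v, ∑ l : Fin (d + 1), wΦ (N := Lc ^ (j + 1)) κ l (u - v) * m l v)
        * colH (coDressKBmAt (toSite r) Lc (KInvStep (d := d) Lc (j + 1))) Lc ν y' κ u = 0 := by
  classical
  rw [tsum_sum_E2image_mul_colH_eq_E2 hr j hmB hm0 ν y']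
  have hq : ∀ κ y, contourSum Lc m κ y = contourSum Lc m κ 0 := fun κ y => by
    have h := contourSum_add_coarse (L := Lc) hper κ 0 y
    rwa [zero_add] at h
  have eE : ∀ (y : Site (d + 1)) κ, E2 d Lc (j + 2) y y' (Sum.inl κ) (Sum.inl ν) = wΦ (N := Lc ^ (j + 2)) κ ν (y - y') := by
    intro y κ
    rw [← colM_coDressKBmAt_KInvStep (toSite r) (j + 1) ν y' κ y, colM_coDressKBmAt, colM_KInvStep]
  have e : ∀ y : Site (d + 1), ∑ κ, E2 d Lc (j + 2) y y' (Sum.inl κ) (Sum.inl ν) * contourSum Lc m κ y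
      = ∑ κ, contourSum Lc m κ 0 * wΦ (N := Lc ^ (j + 2)) κ ν (y - y') := fun y =>
    Finset.sum_congr rfl fun κ _ => by rw [hq κ y, eE y κ, mul_comm]
  have hs : ∀ κ, Summable fun y : Site (d + 1) => wΦ (N := Lc ^ (j + 2)) κ ν (y - y') := fun κ => by
    have h := (summable_wΦ (N := Lc ^ (j + 2)) κ ν).comp_injective (sub_left_injective (b := y'))
    simpa only [Function.comp_def] using h
  have hz : ∀ κ, ∑' y : Site (d + 1), wΦ (N := Lc ^ (j + 2)) κ ν (y - y') = 0 := fun κ => by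
    have h := (Equiv.subRight y').tsum_eq (fun z : Site (d + 1) => wΦ (N := Lc ^ (j + 2)) κ ν z)
    simp only [Equiv.subRight_apply] at h
    rw [h, tsum_wΦ_eq_zero]
  rw [tsum_congr e, Summable.tsum_finsetSum (fun κ _ => (hs κ).mul_left _)]
  simp only [tsum_mul_left, hz, mul_zero, Finset.sum_const_zero]

/-! ## §4 Level `0 → 1`: the Wilson Hessian image climbs to the first value Hessian -/

/-- NOT IN PRINT; OUR BOOKKEEPING.  **LEVEL `0 → 1`** (in-block root, `m` bounded and zero on the comb bonds): `Σ'_u Σ_κ (d*d m)(κ,u)·colH G_0 Lc ν y′ κ u = Σ'_y Σ_κ E2 d Lc 1 y y′ (inl κ)(inl ν)·(𝒬_{Lc} m) κ y`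
— leaf-06 g46's `RelInvWardPairing.ward_pairing_coDressKBmAt_KInvStep_zero` at the identity source `W = idK` (source term `0`: the `(inl, inr)` block of `idK`), and the dictionary
`colM G_0 Lc ν y′ κ y = E2 d Lc 1 y y′ (inl κ)(inl ν)`; `σ_0 = 1`.  With `E2 d Lc 1 y y′ (inl κ)(inl ν) = wΦ_{Lc} κ ν (y − y′) = wΦ_{Lc} ν κ (y′ − y)` this is `(Δ_1 m′)(ν,y′)`, `m′ = wVH_1⁻¹·𝒬_{Lc} m`.
PRIOR ART BY NAME: the `colM`-form of this identity (before the `E2` dictionary) is leaf-06 g47's `CombFreeGaugeLegCharges.tsum_curvAdj_curv_mul_colH_eq` (p337043 ✓, landed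
2026-08-22 18:12Z, same day) — both are ten-line instances of g46's `ward_pairing` at `W = idK`; this file keeps its own instance only to avoid importing FILE A's closure. -/
theorem tsum_sum_curvAdj_curv_mul_colH_zero_eq_E2 (hr : r ∈ box (d + 1) Lc) {m : Form1 (d + 1) ℝ} {B : ℝ} (hmB : ∀ κ u, |m κ u| ≤ B)
    (hm0 : ∀ κ u, IsCombBondAt (toSite r) Lc κ u → m κ u = 0) (ν : Fin (d + 1)) (y' : Site (d + 1)) :
    ∑' u, ∑ κ, curvAdj (curv m) κ u * colH (coDressKBmAt (toSite r) Lc (KInvStep (d := d) Lc 0)) Lc ν y' κ u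
      = ∑' y, ∑ κ, E2 d Lc 1 y y' (Sum.inl κ) (Sum.inl ν) * contourSum Lc m κ y := by
  classical
  have hW := ward_pairing_coDressKBmAt_KInvStep_zero (d := d) hr (W := idK) spr_idK hmB hm0 ((Lc : ℤ) • y') (Sum.inr ν)
  rw [comp_idK_right] at hW
  simp only [colH]
  rw [hW]
  have h1 : (fun u => ∑ κ, m κ u * (idK : MKer (d + 1) (Fib d)) u ((Lc : ℤ) • y') (Sum.inl κ) (Sum.inr ν)) = fun _ => 0 := by
    funext u
    refine Finset.sum_eq_zero fun κ _ => ?_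
    rw [idK_apply, if_neg (fun h => Sum.inl_ne_inr h.2), mul_zero]
  rw [h1, tsum_zero, zero_add]
  refine tsum_congr fun y => Finset.sum_congr rfl fun κ _ => ?_
  have e : coDressKBmAt (toSite r) Lc (KInvStep (d := d) Lc 0) ((Lc : ℤ) • y) ((Lc : ℤ) • y') (Sum.inr κ) (Sum.inr ν)
      = colM (coDressKBmAt (toSite r) Lc (KInvStep (d := d) Lc 0)) Lc ν y' κ y := rfl
  rw [e, colM_coDressKBmAt_KInvStep, mul_comm]

/-! ## §5 The affine step in the consumer's order -/

/-- NOT IN PRINT; OUR BOOKKEEPING.  **THE AFFINE STEP OF THE TOWER** (every `j`, in-block root; `m` bounded and zero on the comb bonds; `c` a per-direction constant): for the slot field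
`C κ u := (Δ_{j+1} m)(κ,u) + c κ` read in the order `Σ_κ Σ'_u colH·C` that `ChargeTowerStep.tsum_weighted_vertexOfK` produces,
`Σ_κ Σ'_u colH G_{j+1} Lc ν y′ κ u·C κ u = wVH_{j+2}·Σ'_y Σ_κ wΦ_{Lc^{j+2}} ν κ (y′ − y)·((σ_{j+1}∕wVH_{j+2})·(𝒬_{Lc} m) κ y) + c ν·(Lc^d·(σ_{j+1}·Lc^{d+1})⁻¹)` — `Δ`-exact-plus-constant in, `Δ`-exact-plus-constant
out, one level up (§3 + §2; the finite∕infinite sum exchange by §1). -/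
theorem sum_tsum_colH_mul_affine (hr : r ∈ box (d + 1) Lc) (j : ℕ) {m : Form1 (d + 1) ℝ} {B : ℝ} (hmB : ∀ κ u, |m κ u| ≤ B)
    (hm0 : ∀ κ u, IsCombBondAt (toSite r) Lc κ u → m κ u = 0) (c : Fin (d + 1) → ℝ) (ν : Fin (d + 1)) (y' : Site (d + 1)) :
    ∑ κ, ∑' u, colH (coDressKBmAt (toSite r) Lc (KInvStep (d := d) Lc (j + 1))) Lc ν y' κ u
        * ((wVH d Lc (j + 1) * ∑' v, ∑ l : Fin (d + 1), wΦ (N := Lc ^ (j + 1)) κ l (u - v) * m l v) + c κ)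
      = wVH d Lc (j + 2) * (∑' y, ∑ κ, wΦ (N := Lc ^ (j + 2)) ν κ (y' - y) * ((stepScale d Lc (j + 1) / wVH d Lc (j + 2)) * contourSum Lc m κ y))
        + c ν * ((Lc : ℝ) ^ d * (stepScale d Lc (j + 1) * (Lc : ℝ) ^ (d + 1))⁻¹) := by
  classical
  -- the exact part is a bounded slot field
  set E : Form1 (d + 1) ℝ := fun κ u => wVH d Lc (j + 1) * ∑' v, ∑ l : Fin (d + 1), wΦ (N := Lc ^ (j + 1)) κ l (u - v) * m l v with hE
  have hEb : ∀ κ u, |E κ u| ≤ |wVH d Lc (j + 1)| * (B * ∑ l : Fin (d + 1), ∑' z : Site (d + 1), |wΦ (N := Lc ^ (j + 1)) κ l z|) := by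
    intro κ u
    simp only [hE]
    rw [abs_mul]
    exact mul_le_mul_of_nonneg_left (abs_tsum_sum_wΦ_mul_le (Lc ^ (j + 1)) hmB κ u) (abs_nonneg _)
  -- a bound uniform in `κ`
  set BE : ℝ := |wVH d Lc (j + 1)| * (B * ∑ κ : Fin (d + 1), ∑ l : Fin (d + 1), ∑' z : Site (d + 1), |wΦ (N := Lc ^ (j + 1)) κ l z|) with hBE
  have hB0 : 0 ≤ B := (abs_nonneg _).trans (hmB 0 0)
  have hEb' : ∀ κ u, |E κ u| ≤ BE := by
    intro κ u
    refine (hEb κ u).trans (mul_le_mul_of_nonneg_left (mul_le_mul_of_nonneg_left ?_ hB0) (abs_nonneg _))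
    exact Finset.single_le_sum (f := fun κ => ∑ l : Fin (d + 1), ∑' z : Site (d + 1), |wΦ (N := Lc ^ (j + 1)) κ l z|)
      (fun κ _ => Finset.sum_nonneg fun l _ => tsum_nonneg fun z => abs_nonneg _) (Finset.mem_univ κ)
  have hsE : ∀ κ, Summable fun u => E κ u * colH (coDressKBmAt (toSite r) Lc (KInvStep (d := d) Lc (j + 1))) Lc ν y' κ u := fun κ =>
    summable_bdd_mul_colH hr (j + 1) hEb' ν y' κ
  have hsc : ∀ κ, Summable fun u => c κ * colH (coDressKBmAt (toSite r) Lc (KInvStep (d := d) Lc (j + 1))) Lc ν y' κ u := fun κ =>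
    (summable_colH hr (j + 1) ν y' κ).mul_left (c κ)
  -- split the affine field and exchange the sums
  have hsplit : ∀ κ, ∑' u, colH (coDressKBmAt (toSite r) Lc (KInvStep (d := d) Lc (j + 1))) Lc ν y' κ u * (E κ u + c κ)
      = (∑' u, E κ u * colH (coDressKBmAt (toSite r) Lc (KInvStep (d := d) Lc (j + 1))) Lc ν y' κ u)
        + ∑' u, c κ * colH (coDressKBmAt (toSite r) Lc (KInvStep (d := d) Lc (j + 1))) Lc ν y' κ u := by
    intro κ
    rw [← (hsE κ).tsum_add (hsc κ)]
    exact tsum_congr fun u => by ring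
  have hgoal : ∑ κ, ∑' u, colH (coDressKBmAt (toSite r) Lc (KInvStep (d := d) Lc (j + 1))) Lc ν y' κ u * (E κ u + c κ)
      = (∑' u, ∑ κ, E κ u * colH (coDressKBmAt (toSite r) Lc (KInvStep (d := d) Lc (j + 1))) Lc ν y' κ u)
        + ∑' u, ∑ κ, c κ * colH (coDressKBmAt (toSite r) Lc (KInvStep (d := d) Lc (j + 1))) Lc ν y' κ u := by
    simp only [hsplit]
    rw [Finset.sum_add_distrib, Summable.tsum_finsetSum (fun κ _ => hsE κ), Summable.tsum_finsetSum (fun κ _ => hsc κ)]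
  rw [show (fun κ => ∑' u, colH (coDressKBmAt (toSite r) Lc (KInvStep (d := d) Lc (j + 1))) Lc ν y' κ u
        * ((wVH d Lc (j + 1) * ∑' v, ∑ l : Fin (d + 1), wΦ (N := Lc ^ (j + 1)) κ l (u - v) * m l v) + c κ))
      = fun κ => ∑' u, colH (coDressKBmAt (toSite r) Lc (KInvStep (d := d) Lc (j + 1))) Lc ν y' κ u * (E κ u + c κ) from rfl]
  rw [hgoal, tsum_sum_E2image_mul_colH_climbs hr j hmB hm0 ν y', tsum_sum_const_mul_colH hr (j + 1) c ν y']

/-! ## §6 The induction step for a generic stencil family: (I1)'s vertex form ⨾ §5 -/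

/-- NOT IN PRINT; OUR BOOKKEEPING.  **THE TOWER'S INDUCTION STEP, EXACT-PLUS-CONSTANT PART, FOR A GENERIC LOCAL STENCIL FAMILY** (every `j`, in-block root; `S` local, `g₁ g₂` bounded; `m` bounded
and zero on the comb bonds; `c` per-direction constants): IF the level-(j+1) weighted charge function of `S` is `Δ_{j+1}`-exact plus constant,
`∀ κ u, Σ'_{(y,w)} g₁(y)·g₂(w)·S κ u y w a b = wVH_{j+1}·Σ'_v Σ_l wΦ_{Lc^{j+1}} κ l (u − v)·m l v + c κ`, THEN the weighted charge of the chain-rule vertex of `S` through `G_{j+1}` is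
`Δ_{j+2}`-exact plus constant with the climbed potential and the column-total constant:
`Σ'_{(y,w)} g₁(y)·(vertexOfK G_{j+1} Lc S ν y′) y w a b·g₂(w) = wVH_{j+2}·Σ'_y Σ_κ wΦ_{Lc^{j+2}} ν κ (y′ − y)·((σ_{j+1}∕wVH_{j+2})·(𝒬_{Lc} m) κ y) + c ν·(Lc^d·(σ_{j+1}·Lc^{d+1})⁻¹)`
(`ChargeTowerStep.tsum_weighted_vertexOfK` unfolds the vertex into the `ℋ`-column read of the charge function; §5 climbs it).  With (I1) `ChargeTowerStep.hasSum_prod_coordWeighted_SpureRecAt_succ_inl_inl`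
(`S := SrecAt (j+1)`, weights `cH_{j+1}·𝟙^{exit}·f∘blk`) this is (I3)_{j+1} ⇒ (I3)_{j+2} for the pure S table modulo the fresh `Λ`∕`VH` pieces of `SrecAt (j+1)` and the re-gauging of `m′`. -/
theorem tsum_weighted_vertexOfK_of_exact_add_const (hr : r ∈ box (d + 1) Lc) (j : ℕ)
    {S : Fin (d + 1) → Site (d + 1) → MKer (d + 1) (Fib d)} {Cs δs : ℝ} (hS : LocStencil S Cs δs) (hδs : 0 < δs)
    (g₁ g₂ : Site (d + 1) → ℝ) {B₁ B₂ : ℝ} (hg₁ : ∀ y, |g₁ y| ≤ B₁) (hg₂ : ∀ w, |g₂ w| ≤ B₂) (a b : Fib d)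
    {m : Form1 (d + 1) ℝ} {B : ℝ} (hmB : ∀ κ u, |m κ u| ≤ B) (hm0 : ∀ κ u, IsCombBondAt (toSite r) Lc κ u → m κ u = 0) (c : Fin (d + 1) → ℝ)
    (hC : ∀ (κ : Fin (d + 1)) (u : Site (d + 1)), ∑' yw : Site (d + 1) × Site (d + 1), g₁ yw.1 * g₂ yw.2 * S κ u yw.1 yw.2 a b
      = (wVH d Lc (j + 1) * ∑' v, ∑ l : Fin (d + 1), wΦ (N := Lc ^ (j + 1)) κ l (u - v) * m l v) + c κ)
    (ν : Fin (d + 1)) (y' : Site (d + 1)) :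
    ∑' yw : Site (d + 1) × Site (d + 1), g₁ yw.1 * vertexOfK (coDressKBmAt (toSite r) Lc (KInvStep (d := d) Lc (j + 1))) Lc S ν y' yw.1 yw.2 a b * g₂ yw.2
      = wVH d Lc (j + 2) * (∑' y, ∑ κ, wΦ (N := Lc ^ (j + 2)) ν κ (y' - y) * ((stepScale d Lc (j + 1) / wVH d Lc (j + 2)) * contourSum Lc m κ y))
        + c ν * ((Lc : ℝ) ^ d * (stepScale d Lc (j + 1) * (Lc : ℝ) ^ (d + 1))⁻¹) := by
  obtain ⟨δ, C, hδ, -, hG⟩ := decays_coDressKBmAt_KInvStep (d := d) hr (j + 1)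
  rw [tsum_weighted_vertexOfK (one_le_of_neZero Lc) hG hδ hS hδs ν y' g₁ g₂ hg₁ hg₂ a b]
  simp only [hC]
  exact sum_tsum_colH_mul_affine hr j hmB hm0 c ν y'

/-! ## §7 The S-pure induction step: (I1) ⨾ §6 -/

omit [NeZero Lc] in
/-- [folklore] Splitting the joint exit indicator of (I1)'s vertex form into the two one-leg weights. -/
theorem ite_and_mul_eq (P Q : Prop) [Decidable P] [Decidable Q] (a b V : ℝ) :
    (if P ∧ Q then a * b * V else 0) = (if P then a else 0) * V * (if Q then b else 0) := by
  by_cases hP : P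
  · by_cases hQ : Q
    · rw [if_pos ⟨hP, hQ⟩, if_pos hP, if_pos hQ]; ring
    · rw [if_neg (fun h => hQ h.2), if_neg hQ, mul_zero]
  · rw [if_neg (fun h => hP h.1), if_neg hP, zero_mul, zero_mul]

/-- NOT IN PRINT; OUR BOOKKEEPING.  **THE S-PURE INDUCTION STEP OF THE TOWER** (every `j`, in-block root, all `cE cVH cΛ`, bounded `f₁ f₂ : ℤ → ℝ`, `m` bounded and zero on the comb bonds, `c` per-direction
constants): IF the charge function of the FULL member `SrecAt (j+1)` against the two EXIT-SUPPORTED BLOCK-CONSTANT weights `g₁ = 𝟙^{exit}_α·f₁∘blk_α`, `g₂ = 𝟙^{exit}_β·f₂∘blk_β` in the channel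
`(inl α, inl β)` is `Δ_{j+1}`-exact plus constant — `∀ κ u, Σ'_{(y,w)} g₁(y)·g₂(w)·SrecAt … (j+1) κ u y w (inl α)(inl β) = (Δ_{j+1} m)(κ,u) + c κ` ((I3)_{j+1}) — THEN the class-𝒟 charge function of the
pure S member TWO levels up the typed ladder, `(x,z) ↦ f₁(x_α)·f₂(z_β)·SpureRecAt … (j+2) ν y′ x z (inl α)(inl β)`, has the sum
`(cE·wE_{j+2})·cH_{j+1}²·(wVH_{j+2}·Σ'_y Σ_κ wΦ_{Lc^{j+2}} ν κ (y′ − y)·((σ_{j+1}∕wVH_{j+2})·(𝒬_{Lc} m) κ y) + c ν·Lc^d·(σ_{j+1}·Lc^{d+1})⁻¹)` — `Δ_{j+2}`-EXACT PLUS CONSTANT in the slot `(ν,y′)`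
((I1) `ChargeTowerStep.hasSum_prod_coordWeighted_SpureRecAt_succ_inl_inl` ⨾ §6).  The hypothesis is on the FULL member (S + Λ + VH shares); supplying it from (I3) of the pure S member plus
the Λ∕VH lemmas, and re-gauging `m′`, is the assembly left to the next file. -/
theorem hasSum_prod_coordWeighted_SpureRecAt_of_exact_add_const (hr : r ∈ box (d + 1) Lc) (cE cVH cΛ : ℝ) (j : ℕ) (α β : Fin (d + 1))
    (f₁ f₂ : ℤ → ℝ) {B₁ B₂ : ℝ} (hf₁ : ∀ s, |f₁ s| ≤ B₁) (hf₂ : ∀ s, |f₂ s| ≤ B₂)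
    {m : Form1 (d + 1) ℝ} {B : ℝ} (hmB : ∀ κ u, |m κ u| ≤ B) (hm0 : ∀ κ u, IsCombBondAt (toSite r) Lc κ u → m κ u = 0) (c : Fin (d + 1) → ℝ)
    (hC : ∀ (κ : Fin (d + 1)) (u : Site (d + 1)), ∑' yw : Site (d + 1) × Site (d + 1),
        (if yw.1 α % (Lc : ℤ) = (Lc : ℤ) - 1 then f₁ (blk Lc yw.1 α) else 0) * (if yw.2 β % (Lc : ℤ) = (Lc : ℤ) - 1 then f₂ (blk Lc yw.2 β) else 0)
          * SrecAt d Lc (toSite r) cE cVH cΛ (j + 1) κ u yw.1 yw.2 (Sum.inl α) (Sum.inl β)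
      = (wVH d Lc (j + 1) * ∑' v, ∑ l : Fin (d + 1), wΦ (N := Lc ^ (j + 1)) κ l (u - v) * m l v) + c κ)
    (ν : Fin (d + 1)) (y' : Site (d + 1)) :
    HasSum (fun xz : Site (d + 1) × Site (d + 1) => f₁ (xz.1 α) * f₂ (xz.2 β) *
        SpureRecAt d Lc (toSite r) cE cVH cΛ (j + 2) ν y' xz.1 xz.2 (Sum.inl α) (Sum.inl β))
      ((cE * wE d Lc (j + 2)) * ((stepScale d Lc (j + 1) * (Lc : ℝ) ^ (d + 1))⁻¹ ^ 2 *
        (wVH d Lc (j + 2) * (∑' y, ∑ κ, wΦ (N := Lc ^ (j + 2)) ν κ (y' - y) * ((stepScale d Lc (j + 1) / wVH d Lc (j + 2)) * contourSum Lc m κ y))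
          + c ν * ((Lc : ℝ) ^ d * (stepScale d Lc (j + 1) * (Lc : ℝ) ^ (d + 1))⁻¹)))) := by
  classical
  have hLc : 1 ≤ Lc := one_le_of_neZero Lc
  obtain ⟨Cs, δs, hδs, hS⟩ := locStencil_SrecAt (d := d) (Lc := Lc) hLc hr cE cVH cΛ (j + 1)
  have hB₁ : 0 ≤ B₁ := (abs_nonneg _).trans (hf₁ 0)
  have hB₂ : 0 ≤ B₂ := (abs_nonneg _).trans (hf₂ 0)
  -- the two one-leg weights are bounded
  set g₁ : Site (d + 1) → ℝ := fun y => if y α % (Lc : ℤ) = (Lc : ℤ) - 1 then f₁ (blk Lc y α) else 0 with hg₁def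
  set g₂ : Site (d + 1) → ℝ := fun w => if w β % (Lc : ℤ) = (Lc : ℤ) - 1 then f₂ (blk Lc w β) else 0 with hg₂def
  have hg₁ : ∀ y, |g₁ y| ≤ B₁ := fun y => by
    simp only [hg₁def]; split_ifs
    · exact hf₁ _
    · rw [abs_zero]; exact hB₁
  have hg₂ : ∀ w, |g₂ w| ≤ B₂ := fun w => by
    simp only [hg₂def]; split_ifs
    · exact hf₂ _
    · rw [abs_zero]; exact hB₂
  have hC' : ∀ (κ : Fin (d + 1)) (u : Site (d + 1)), ∑' yw : Site (d + 1) × Site (d + 1),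
      g₁ yw.1 * g₂ yw.2 * SrecAt d Lc (toSite r) cE cVH cΛ (j + 1) κ u yw.1 yw.2 (Sum.inl α) (Sum.inl β)
        = (wVH d Lc (j + 1) * ∑' v, ∑ l : Fin (d + 1), wΦ (N := Lc ^ (j + 1)) κ l (u - v) * m l v) + c κ := fun κ u => by
    simp only [hg₁def, hg₂def]; exact hC κ u
  have key := tsum_weighted_vertexOfK_of_exact_add_const hr j hS hδs g₁ g₂ hg₁ hg₂ (Sum.inl α) (Sum.inl β) hmB hm0 c hC' ν y'
  -- (I1) at level `j + 1`
  have h := hasSum_prod_coordWeighted_SpureRecAt_succ_inl_inl hr cE cVH cΛ (j + 1) ν y' α β f₁ f₂ hf₁ hf₂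
  have e : (∑' yw : Site (d + 1) × Site (d + 1),
      (if yw.1 α % (Lc : ℤ) = (Lc : ℤ) - 1 ∧ yw.2 β % (Lc : ℤ) = (Lc : ℤ) - 1 then
        f₁ (blk Lc yw.1 α) * f₂ (blk Lc yw.2 β) *
          vertexOfK (coDressKBmAt (toSite r) Lc (KInvStep (d := d) Lc (j + 1))) Lc (SrecAt d Lc (toSite r) cE cVH cΛ (j + 1)) ν y' yw.1 yw.2
            (Sum.inl α) (Sum.inl β) else 0))
      = wVH d Lc (j + 2) * (∑' y, ∑ κ, wΦ (N := Lc ^ (j + 2)) ν κ (y' - y) * ((stepScale d Lc (j + 1) / wVH d Lc (j + 2)) * contourSum Lc m κ y))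
        + c ν * ((Lc : ℝ) ^ d * (stepScale d Lc (j + 1) * (Lc : ℝ) ^ (d + 1))⁻¹) := by
    rw [← key]
    refine tsum_congr fun yw => ?_
    rw [ite_and_mul_eq]
  rw [e] at h
  exact h

end Summit.QuantumFields.BalabanUV.Beta.GAN24.ChargeTowerClimb

end
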